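import Summits.HodgeConjecture.CorCM.Assembly.CorCMOfPeriodThmF
import Summits.HodgeConjecture.CorCM.Interfaces
import Summits.HodgeConjecture.CorCM.Model.Universe2Transfer
import Summits.HodgeConjecture.CorCM.Model.Universe2FactorAct
import Summits.HodgeConjecture.CorCM.Model.Universe2WeightDual
import Summits.HodgeConjecture.CorCM.Model.Universe2Gysin
import Summits.HodgeConjecture.CorCM.Model.ModelAxiomsOfRows
import Summits.HodgeConjecture.CorCM.Model.AlgDualityHolds
import HarnessLib

/-!
# ROAD 2 of the stage-2 E term: the package chain ON THE SECOND MODEL UNIVERSE `Model2.universe₂`, whose junction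
# with `HC_CM` is KERNEL (no domination binder at the junction)

Cell `pub-hodgecm2` (COR-CM), seat model-2 (gen 2).  Road 1 (`CorCM/DictionaryA3.lean`, `Assembly/ModelChain.lean`) runs
`Assembly.hc_cm_of_periodThmF` on the model of record `Model.picardCMUniverse` and passes to `HC_CM` through the
Milne-1999 edge with the guarded domination binder `dom` (B03).  Road 2 runs THE SAME chain on `universe₂` — whose
`ModelAxioms` are the model of record's plus M14 modulo `hR` (`Model2.modelAxioms₂_of_riemann`), whose open inputs N1–N4, F2,
F4–F7 are the twins of `Model/Universe2{CupFacts,FactorAct,WeightDual,Gysin}.lean`, and whose period hypothesis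
`universe₂.PerLFace` IS `universeOf.PerLFace` (`Iff.rfl`) — and passes to `HC_CM` by the KERNEL junction
`Model2.HC_CM_iff_CMAbelianHodge` (p228380): no binder at the junction.

* `hc_cm₂_of_rows` — `universeOf.ModelAxioms`, Riemann's theorem `hR` (M14 of `universe₂`), `PeriodThmF` ⟹ `universe₂.HC_CM`;
* `hc_cm_of_PerLFace_road2 (h28)` — the E term along road 2 modulo row M22 (rows assembled by b10's `Model.modelAxioms_of_rows`);
* `example : HC_CM_of_PerLFace` — the CLOSED road-2 term (row M22 = model-1's `Model.universeOf_algDuality`), and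
  `example (hB01 : PerLFace_of_PerL) : HC_CM_of_PerL` — recorded as `example`s per RULING E-DEDUP (the named closed constants live
  once, in road 1's `Assembly/ModelChain.lean`);
* `hc_cm_of_PerLFace_of_modelChain₂` — the E-term shape of road 2: a chain `hR → U₂.PerLFace → U₂.HC_CM` on
  `U₂ := Model2.picardCMUniverse₂ …` gives `HC_CM_of_PerLFace` OUTRIGHT (compare `hc_cm_of_PerLFace_of_modelChain (dom) (chain)`).

Every open geometric input of the chain (N1–N4, F2, F4–F7) is a THEOREM for `universe₂` (`Model/Universe2{CupFacts,FactorAct,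
WeightDual,Gysin}.lean`), so road 2 reduces the working target to: the model of record's 28 `ModelAxioms` + `hR`.
-/

noncomputable section

namespace Summit.HodgeConjecture.CorCM

namespace Model2

open Literature.NumberTheory.Automorphic
open Literature.NumberTheory.Automorphic.PicardCM (BallQuotientUniformisedDatum CMAbelianVarietyRealised
  BallQuotientUniformised ballQuotientUniformisedDatum_of)
open Literature.AlgebraicGeometry.HodgeTheory


/-- **COR-CM read in the second model universe, from the rows.**  The model of record's `ModelAxioms`, Riemann's
theorem (for M14 of `universe₂`) and the face period theorem give `universe₂.HC_CM` by the package chain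
`Assembly.hc_cm_of_periodThmF` — every open geometric input (N1–N4, F2, F4–F7) being a theorem for `universe₂`. [folklore] -/
theorem hc_cm₂_of_rows (hHD : exists_isReal_hodgeModel) (hI : hodgePQ_independent_of_hodgeModel)
    (hU : BallQuotientUniformisedDatum) (h₃ : CMAbelianVarietyRealised) (M : (Model.universeOf hHD hI hU h₃).ModelAxioms)
    (hR : DeligneMilne1982_Thm_6_20_full) (hF : (universe₂ hHD hI hU h₃).PeriodThmF) : (universe₂ hHD hI hU h₃).HC_CM :=
  have M₂ : (universe₂ hHD hI hU h₃).ModelAxioms := modelAxioms₂_of_riemann hHD hI hU h₃ M hR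
  Assembly.hc_cm_of_periodThmF (universe₂ hHD hI hU h₃) M₂ hF
    (universe₂_fact_cupExterior hHD hI hU h₃) (universe₂_fact_cup_hodge hHD hI hU h₃)
    (universe₂_fact_pull_H0 hHD hI hU h₃) (universe₂_fact_hodge_F0 hHD hI hU h₃)
    (universe₂_fact_factorActDescends hHD hI hU h₃ M₂) (universe₂_fact_cupAlg hHD hI hU h₃)
    (universe₂_fact_cupAssoc hHD hI hU h₃) (universe₂_fact_weightDual hHD hI hU h₃ M₂) (universe₂_fact_gysin hHD hI hU h₃)

/-- **The E-term item from the rows, road 2** (no binder at the junction): the same hypotheses with the period theorem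
READ ON THE MODEL OF RECORD give `RankFourFaces.CMAbelianHodge` = `HC_CM` by name. [folklore] -/
theorem hc_cm_of_rows₂ (hHD : exists_isReal_hodgeModel) (hI : hodgePQ_independent_of_hodgeModel)
    (hU : BallQuotientUniformisedDatum) (h₃ : CMAbelianVarietyRealised) (M : (Model.universeOf hHD hI hU h₃).ModelAxioms)
    (hR : DeligneMilne1982_Thm_6_20_full) (hF : (Model.universeOf hHD hI hU h₃).PeriodThmF) : HC_CM :=
  (HC_CM_iff_CMAbelianHodge hHD hI hU h₃).1
    (hc_cm₂_of_rows hHD hI hU h₃ M hR ((periodThmF_iff_universeOf hHD hI hU h₃).2 hF))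

/-- **Road 2 of the E term's shape.**  A proof of the package chain ON THE SECOND MODEL (`hR → U₂.PerLFace → U₂.HC_CM` for
`U₂ := Model2.picardCMUniverse₂ hHD hI h₁ h₃`) gives the working target `HC_CM_of_PerLFace` OUTRIGHT: the stage-1
hypothesis `(Model.picardCMUniverse …).PerLFace` IS `U₂.PerLFace` (`periodThmF_iff_universeOf`, definitional) and `U₂.HC_CM`
IS `HC_CM` (`picardCMUniverse₂_HC_CM_iff_CMAbelianHodge`, kernel) — compare road 1,
`hc_cm_of_PerLFace_of_modelChain (dom) (chain)` with its domination binder `dom` (B03). [folklore] -/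
theorem hc_cm_of_PerLFace_of_modelChain₂
    (chain₂ : ∀ (hHD : exists_isReal_hodgeModel) (hI : hodgePQ_independent_of_hodgeModel)
      (h₁ : BallQuotientUniformised) (h₃ : CMAbelianVarietyRealised),
      DeligneMilne1982_Thm_6_20_full → (picardCMUniverse₂ hHD hI h₁ h₃).PerLFace → (picardCMUniverse₂ hHD hI h₁ h₃).HC_CM) :
    HC_CM_of_PerLFace :=
  fun hHD hI h₁ h₃ hP hR => (picardCMUniverse₂_HC_CM_iff_CMAbelianHodge hHD hI h₃ h₁).1 (chain₂ hHD hI h₁ h₃ hR hP)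

/-- **Road 2, rows form.**  If, over the displayed records and Riemann's theorem `hR`, the model of record satisfies its
28 `ModelAxioms` (rows M·), then `HC_CM_of_PerLFace` — NOTHING ELSE is asked: the open geometric inputs N1–N4, F2, F4–F7 are
theorems for the second model, M14 of the second model is a theorem modulo `hR`, and the junction is kernel. [folklore] -/
theorem hc_cm_of_PerLFace_of_rows₂
    (rowsM : ∀ (hHD : exists_isReal_hodgeModel) (hI : hodgePQ_independent_of_hodgeModel)
      (h₁ : BallQuotientUniformised) (h₃ : CMAbelianVarietyRealised),
      DeligneMilne1982_Thm_6_20_full → (Model.picardCMUniverse hHD hI h₁ h₃).ModelAxioms) :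
    HC_CM_of_PerLFace :=
  hc_cm_of_PerLFace_of_modelChain₂ fun hHD hI h₁ h₃ hR hP =>
    hc_cm₂_of_rows hHD hI (ballQuotientUniformisedDatum_of h₁) h₃ (rowsM hHD hI h₁ h₃ hR) hR hP

/-- **ROAD 2 OF THE E TERM, MODULO ROW M22 ONLY.**  With the rows of the model of record assembled by b10's
`Model.modelAxioms_of_rows` (every field a tree theorem over `hR` except M22 `Fact_algDuality`, hypothesis `h28` BY NAME, allowed to
use the displayed `hR`), the working target `HC_CM_of_PerLFace` follows along road 2 — no domination binder, no open geometric input.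
When row M22 lands for `Model.picardCMUniverse`, instantiate `h28` and the term closes. [folklore] -/
theorem hc_cm_of_PerLFace_road2
    (h28 : ∀ (hHD : exists_isReal_hodgeModel) (hI : hodgePQ_independent_of_hodgeModel)
      (h₁ : BallQuotientUniformised) (h₃ : CMAbelianVarietyRealised),
      DeligneMilne1982_Thm_6_20_full → (Model.picardCMUniverse hHD hI h₁ h₃).Fact_algDuality) :
    HC_CM_of_PerLFace :=
  hc_cm_of_PerLFace_of_rows₂ fun hHD hI h₁ h₃ hR =>
    Model.modelAxioms_of_rows hHD hI (ballQuotientUniformisedDatum_of h₁) h₃ hR (h28 hHD hI h₁ h₃ hR)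

/-- **`universe₂.ModelAxioms`, UNCONDITIONALLY modulo Riemann's theorem** (all 28 rows of the model of record are tree theorems
over `hR`: b10's `Model.modelAxioms_of_rows` with row M22 = model-1's `Model.universeOf_algDuality`), transferred by
`modelAxioms₂_of_riemann`. [folklore] -/
theorem universe₂_modelAxioms (hHD : exists_isReal_hodgeModel) (hI : hodgePQ_independent_of_hodgeModel)
    (hU : BallQuotientUniformisedDatum) (h₃ : CMAbelianVarietyRealised) (hR : DeligneMilne1982_Thm_6_20_full) :
    (universe₂ hHD hI hU h₃).ModelAxioms :=
  modelAxioms₂_of_riemann hHD hI hU h₃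
    (Model.modelAxioms_of_rows hHD hI hU h₃ hR (Model.universeOf_algDuality hHD hI hU h₃)) hR

/-- **THE WORKING STAGE-2 TARGET ALONG ROAD 2: `HC_CM_of_PerLFace` — closed, kernel-checked, recorded as an `example`**
(RULING E-DEDUP 2026-08-20T22:00Z: the closed constant of record `… : HC_CM_of_PerLFace` lives ONCE in the tree, in road 1's
`Assembly/ModelChain.lean`; the gate's `dedup.landed` is statement-level).  For every instance of the records `hHD hI h₁ h₃`, the face
period theorem on the model of record together with Riemann's theorem `hR` implies the Hodge conjecture for every complex abelian
variety of CM type (`HC_CM` = `RankFourFaces.CMAbelianHodge` by name) — via the package chain on the second model universe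
`Model2.picardCMUniverse₂` (all 28 model rows + the nine open geometric inputs are tree theorems; M14 of the second model modulo
`hR`; row M22 = model-1's `Model.universeOf_algDuality`), passed to `HC_CM` by the KERNEL junction
`picardCMUniverse₂_HC_CM_iff_CMAbelianHodge`; no domination binder. -/
example : HC_CM_of_PerLFace :=
  hc_cm_of_PerLFace_road2 fun hHD hI h₁ h₃ _ =>
    Model.universeOf_algDuality hHD hI (ballQuotientUniformisedDatum_of h₁) h₃

/-- **The literal stage-2 target along road 2, modulo binder B01 only** (recorded as an `example`, RULING E-DEDUP): `HC_CM_of_PerL`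
from the closed road-2 term and the residual implication `PerLFace_of_PerL` (gap G-T, `Interfaces.hc_cm_of_PerL_of_face`). -/
example (hB01 : PerLFace_of_PerL) : HC_CM_of_PerL :=
  hc_cm_of_PerL_of_face
    (hc_cm_of_PerLFace_road2 fun hHD hI h₁ h₃ _ => Model.universeOf_algDuality hHD hI (ballQuotientUniformisedDatum_of h₁) h₃)
    hB01

end Model2

end Summit.HodgeConjecture.CorCM

end
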